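import Summits.QuantumFields.YangMills.Theorems.BalabanUVNodesK0Stub1Eq158FlatOpsAtRecord
import Summits.QuantumFields.YangMills.Theorems.UnitScaleTiltProp8FlatScalarExtension
import HarnessLib

/-!
# K0⁷ STUB 1 (`stub_prop8StepCoP13`), sub-target S4a: **[15] (127)∕(128) ⟹ (143)∕(158) WITH PRINT's EXPLICIT MULTI-LEVEL FLAT OPERATORS OF ANY NESTED
# DOMAIN FAMILY, ON THE PROP.-6 CARRIER `PBond P 0 → M_N(ℂ)`** — g0's file 5 (`…K0Stub1Eq158FlatOpsAtRecord`: the scalar carrier `BondSpace P`) ⊗ UST's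
# `FlatScalarExtension` (print p. 288: «we have suppressed matrix indices of operators acting on the Lie algebra valued functions»): the componentwise
# ℂ-linear extensions `Δ_{a,V}`, `Q_V`, `H_V`, `G̃_V` of lit-balaban's `deltaAE D`, `QE D`, `hOp`, `GE − hOp∘QE∘GE` inherit the implication, for SKEW-HERMITIAN
# (Lie-algebra-valued) fields and test fields, with print's pairing (27) `Σ_b Re tr(δ_b* E_b)` (= S1's `⟪·,·⟫` on `TangentBondSU`)

Cell `pub-ymgap`, width seat `pub-ymgap-k0-s1-w1` g2 (INTENT-3).  `--kind proof --supports stmt-QuantumFields-20541 --as helper`; count-neutral.  [15] = [Balaban1985Variational]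
(CMP **102** (1985) 277–309); [B6] = [Balaban1984PropagatorsII] (CMP **96** (1984) 223–250).

WHY.  g0's file 5 proves, on lit-balaban's REAL SCALAR carrier `BondSpace P` and for EVERY nested family `D : Domains P` (the cube sequence (144) included): if `A′` is
critical in the sense (128) — `⟨δ, Δ_aA′ + w⟩ = 0` for all `δ ∈ ker Q` — then `A′ − H(QA′) = −G̃w` with PRINT's `H = GQ*(QGQ*)⁻¹` and `G̃ = G − HQG`.  The consumers of
(158) work on MATRIX-valued bond fields: UST's Prop. 6 (`FlatSmallSolution158*`, g0 file 1) takes `G̃` as a ℂ-linear operator on `ι → V`, `V = 𝔤ᶜ ⊂ M_N(ℂ)`, produced from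
the scalar operator by `FlatScalarExtension.exists_extension` (`(G_V A)(b) = Σ_i (g e_i)(b)·A(i)`); S1's tangent directions and k0-s1-w2's multiplier forms are
𝔲(N)∕𝔰𝔲(N)-valued fields with the pairing `Σ_b Re tr(δ_b* E_b)`.  THIS FILE transfers file 5 to that carrier ONCE, generically: for ANY finite index types and ANY scalar
operators `Δ, Q, H, G̃` for which the scalar implication «(128) ⟹ (143)» holds, their componentwise extensions satisfy it for skew-Hermitian `A′`, `w` against
skew-Hermitian test fields (§1) — each of the `2N²` real components of a skew field is reached by the skew test fields `y·(E_{ii′} − E_{i′i})`, `y·i(E_{ii′} + E_{i′i})` —;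
§2 instantiates with file 5 at every `D` and at the record's fine torus.

WHAT IS PROVED (sorry-free; no definition; axioms standard).
* §0 `extension_entry_re ∕ _im` (a componentwise extension acts on each real component as the scalar operator), `extension_real_smul`, `extension_skew` (real kernels
  preserve skew-Hermitian values), `re_trace_testRe ∕ re_trace_testIm` (the pairings of the two skew test fields with a skew field pick out `2·Re E_{ii′}`, `2·Im E_{ii′}`).
* §1 ★★ `eq143_matrix_of_scalar` — GENERIC TRANSFER: scalar «(128) ⟹ (143)» for `(Δ, Q, H, G̃)` ⇒ the same for the extensions `(Δ_V, Q_V, H_V, G̃_V)` on skew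
  `M_N(ℂ)`-valued fields with skew test fields; ★ `eq158_matrix_of_scalar` ((158) shape: `A₁ + G̃_V(W(A₁ + H_VB)) = 0`, `A₁ = A′ − H_V(Q_VA′)`, `B = Q_VA′`, `w = W A′`).
* §2 `exists_extensions_flatOps` (A6: the four extensions EXIST with the displayed kernel formulas — UST `exists_extension` at the plain-function editions of the scalar
  operators), ★★ `eq143_flatOps_matrixFields` ∕ ★★ `eq158_flatOps_matrixFields` — file 5's `eq143_of_critical128_flatOps` (lit-balaban's `deltaAE D c w`, `QE D`, UST `hOp`,
  `GE`, every `D : Domains P`, `c ≠ 0`, weights `> 0`) transferred: for every quadruple of componentwise extensions and every skew `A′`, `w`∕`W`, (128) in the pairing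
  `Σ_b Re tr(δ_b*(Δ_{a,V}A′ + w)_b)` against skew test fields with `Q_Vδ = 0` ⇒ (143)∕(158) with print's operators; `eq158_flatOps_matrixFields_T4` at `Site (F.P K) 0`.
HONEST SCOPE.  Exact finite-dimensional algebra; the extensions are HYPOTHESES characterised by their kernel formula (inhabited: `exists_extensions_flatOps`; the scalar
implication is file 5's THEOREM; the (128) hypothesis is inhabited trivially by `A′ = 0`, its CONTENTFUL inhabitant is S2's chart at a critical configuration); FLAT background; no letter∕estimate (the port, k0-s1-w3's S5
road (b)); the passage from curve-criticality to (128) (S2's chart) and the identification of `Q_V` with the linearised averaging of record are NOT here; nothing of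
Bałaban's analysis asserted; `stub_prop8StepCoP13` ∕ K0⁷ NOT closed; N07 NOT discharged; counts unmoved (28∕28 · 5∕27); one finite 𝕋⁴ programme at fixed ε — R4 closes
the conditional finite-𝕋⁴ rung `BalabanLadder.UV` only, never the summit; the YM mass gap (Clay) is NOT proved by any of this; nothing continuum ∕ ℝ⁴ ∕ OS.
No `sorry`, no `def`, no `instance`, no `notation`.

References: [15] (27) p.282, p.288, (127)–(133) pp.297–298, (143) p.300, (156)–(158) p.302; [B6] (2.19)–(2.22) p.226.
-/

set_option autoImplicit false
noncomputable section
open scoped BigOperators InnerProductSpace RealInnerProductSpace Matrix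

namespace Summit.QuantumFields.YangMills.Theorems.K0Stub1Eq158FlatOpsMatrixFields

open Summit.QuantumFields.YangMills.Theorems.FlatScalarExtension (apply_eq_sum_kernel exists_extension)

/-! ## §0  Componentwise extensions: entries, real scalings, skewness; the two skew test fields -/

section Generic

variable {ι κ : Type*} [Fintype ι] [DecidableEq ι] {n : Type*}

/-- **A COMPONENTWISE EXTENSION ACTS ON EACH REAL COMPONENT AS THE SCALAR OPERATOR** (real part of the `(i,i′)` entry): for `G_V` with `(G_V A)(b) = Σ_j (g e_j)(b)·A(j)`,
`Re((G_V A)(b)_{ii′}) = (g (Re A_{ii′}))(b)`. [cite: Balaban1985Variational, p.288 («suppressed matrix indices»)] -/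
theorem extension_entry_re (g : (ι → ℝ) →ₗ[ℝ] (κ → ℝ)) {Gv : (ι → Matrix n n ℂ) →ₗ[ℂ] (κ → Matrix n n ℂ)}
    (hGv : ∀ (A : ι → Matrix n n ℂ) (b : κ), Gv A b = ∑ j, ((g (Pi.single j 1) b : ℝ) : ℂ) • A j)
    (A : ι → Matrix n n ℂ) (b : κ) (i i' : n) : (Gv A b i i').re = g (fun j => (A j i i').re) b := by
  rw [hGv, apply_eq_sum_kernel g (fun j => (A j i i').re) b, Matrix.sum_apply, Complex.re_sum]
  refine Finset.sum_congr rfl fun j _ => ?_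
  rw [Matrix.smul_apply, smul_eq_mul, Complex.re_ofReal_mul, mul_comm]

/-- … and the imaginary part: `Im((G_V A)(b)_{ii′}) = (g (Im A_{ii′}))(b)`. [cite: Balaban1985Variational, p.288] -/
theorem extension_entry_im (g : (ι → ℝ) →ₗ[ℝ] (κ → ℝ)) {Gv : (ι → Matrix n n ℂ) →ₗ[ℂ] (κ → Matrix n n ℂ)}
    (hGv : ∀ (A : ι → Matrix n n ℂ) (b : κ), Gv A b = ∑ j, ((g (Pi.single j 1) b : ℝ) : ℂ) • A j)
    (A : ι → Matrix n n ℂ) (b : κ) (i i' : n) : (Gv A b i i').im = g (fun j => (A j i i').im) b := by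
  rw [hGv, apply_eq_sum_kernel g (fun j => (A j i i').im) b, Matrix.sum_apply, Complex.im_sum]
  refine Finset.sum_congr rfl fun j _ => ?_
  rw [Matrix.smul_apply, smul_eq_mul, Complex.im_ofReal_mul, mul_comm]

/-- `G_V(j ↦ y(j)·B) = (b ↦ (gy)(b)·B)` for a real field `y` and a fixed matrix `B` (UST `extension_apply_real_smul`, restated without the norm instances).
[cite: Balaban1985Variational, p.288] -/
theorem extension_real_smul (g : (ι → ℝ) →ₗ[ℝ] (κ → ℝ)) {Gv : (ι → Matrix n n ℂ) →ₗ[ℂ] (κ → Matrix n n ℂ)}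
    (hGv : ∀ (A : ι → Matrix n n ℂ) (b : κ), Gv A b = ∑ j, ((g (Pi.single j 1) b : ℝ) : ℂ) • A j)
    (y : ι → ℝ) (B : Matrix n n ℂ) (b : κ) : Gv (fun j => ((y j : ℝ) : ℂ) • B) b = ((g y b : ℝ) : ℂ) • B := by
  rw [hGv, apply_eq_sum_kernel g y b, Complex.ofReal_sum, Finset.sum_smul]
  refine Finset.sum_congr rfl fun j _ => ?_
  rw [smul_smul, Complex.ofReal_mul, mul_comm]

/-- **REAL KERNELS PRESERVE SKEW-HERMITIAN VALUES**: if every `A(j)` is skew-Hermitian, so is every `(G_V A)(b)` (Lie-algebra-valued fields stay Lie-algebra-valued).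
[cite: Balaban1985Variational, p.288] -/
theorem extension_skew (g : (ι → ℝ) →ₗ[ℝ] (κ → ℝ)) {Gv : (ι → Matrix n n ℂ) →ₗ[ℂ] (κ → Matrix n n ℂ)}
    (hGv : ∀ (A : ι → Matrix n n ℂ) (b : κ), Gv A b = ∑ j, ((g (Pi.single j 1) b : ℝ) : ℂ) • A j)
    {A : ι → Matrix n n ℂ} (hA : ∀ j, (A j)ᴴ = -A j) (b : κ) : (Gv A b)ᴴ = -(Gv A b) := by
  rw [hGv, Matrix.conjTranspose_sum, ← Finset.sum_neg_distrib]
  refine Finset.sum_congr rfl fun j _ => ?_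
  rw [Matrix.conjTranspose_smul, Complex.star_def, Complex.conj_ofReal, hA j, smul_neg]

/-- Entries of a skew-Hermitian matrix: `Re E_{i′i} = −Re E_{ii′}`, `Im E_{i′i} = Im E_{ii′}`. [folklore] -/
theorem skew_entries {E : Matrix n n ℂ} (hE : Eᴴ = -E) (i i' : n) : (E i' i).re = -(E i i').re ∧ (E i' i).im = (E i i').im := by
  have h : star (E i' i) = -(E i i') := by
    have := congrFun (congrFun hE i) i'
    rwa [Matrix.conjTranspose_apply, Matrix.neg_apply] at this
  have hre := congrArg Complex.re h
  have him := congrArg Complex.im h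
  rw [Complex.star_def, Complex.conj_re, Complex.neg_re] at hre
  rw [Complex.star_def, Complex.conj_im, Complex.neg_im] at him
  exact ⟨hre, by linarith⟩

section TestFields

variable [DecidableEq n]

/-- **THE REAL TEST MATRIX** `c·(E_{ii′} − E_{i′i})` (`c` real) is skew-Hermitian. [folklore] -/
theorem testRe_skew (c : ℝ) (i i' : n) :
    (((c : ℝ) : ℂ) • (Matrix.single i i' (1 : ℂ) - Matrix.single i' i (1 : ℂ)))ᴴ =
      -(((c : ℝ) : ℂ) • (Matrix.single i i' (1 : ℂ) - Matrix.single i' i (1 : ℂ))) := by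
  rw [Matrix.conjTranspose_smul, Complex.star_def, Complex.conj_ofReal, Matrix.conjTranspose_sub, Matrix.conjTranspose_single,
    Matrix.conjTranspose_single, star_one, ← smul_neg, neg_sub]

/-- **THE IMAGINARY TEST MATRIX** `c·i(E_{ii′} + E_{i′i})` (`c` real) is skew-Hermitian. [folklore] -/
theorem testIm_skew (c : ℝ) (i i' : n) :
    (((c : ℝ) : ℂ) • (Matrix.single i i' Complex.I + Matrix.single i' i Complex.I))ᴴ =
      -(((c : ℝ) : ℂ) • (Matrix.single i i' Complex.I + Matrix.single i' i Complex.I)) := by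
  rw [Matrix.conjTranspose_smul, Complex.star_def, Complex.conj_ofReal, Matrix.conjTranspose_add, Matrix.conjTranspose_single,
    Matrix.conjTranspose_single, Complex.star_def, Complex.conj_I, ← smul_neg]
  congr 1
  ext a b
  simp only [Matrix.add_apply, Matrix.neg_apply, Matrix.single_apply]
  split_ifs <;> ring

variable [Fintype n]

/-- Pairing of the real test matrix with `E`: `Re tr((c(E_{ii′} − E_{i′i}))* E) = c·(Re E_{ii′} − Re E_{i′i})`. [cite: Balaban1985Variational, (27) p.282 (bookkeeping)] -/
theorem re_trace_testRe (c : ℝ) (i i' : n) (E : Matrix n n ℂ) :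
    ((((c : ℝ) : ℂ) • (Matrix.single i i' (1 : ℂ) - Matrix.single i' i (1 : ℂ)))ᴴ * E).trace.re = c * ((E i i').re - (E i' i).re) := by
  rw [testRe_skew, Matrix.neg_mul, Matrix.trace_neg, Matrix.smul_mul, Matrix.trace_smul, Matrix.sub_mul, Matrix.trace_sub,
    Matrix.trace_single_mul, Matrix.trace_single_mul]
  simp only [smul_eq_mul, one_mul, Complex.neg_re, Complex.mul_re, Complex.ofReal_re, Complex.ofReal_im, zero_mul, sub_zero,
    Complex.sub_re]
  ring

/-- Pairing of the imaginary test matrix with `E`: `Re tr((c·i(E_{ii′} + E_{i′i}))* E) = c·(Im E_{ii′} + Im E_{i′i})`. [cite: Balaban1985Variational, (27) p.282 (bookkeeping)] -/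
theorem re_trace_testIm (c : ℝ) (i i' : n) (E : Matrix n n ℂ) :
    ((((c : ℝ) : ℂ) • (Matrix.single i i' Complex.I + Matrix.single i' i Complex.I))ᴴ * E).trace.re = c * ((E i i').im + (E i' i).im) := by
  rw [testIm_skew, Matrix.neg_mul, Matrix.trace_neg, Matrix.smul_mul, Matrix.trace_smul, Matrix.add_mul, Matrix.trace_add,
    Matrix.trace_single_mul, Matrix.trace_single_mul]
  simp only [smul_eq_mul, Complex.neg_re, Complex.mul_re, Complex.ofReal_re, Complex.ofReal_im, zero_mul, sub_zero, Complex.add_re,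
    Complex.I_re, Complex.I_im, one_mul, zero_sub]
  ring

end TestFields

/-! ## §1  ★★ The generic transfer: scalar «(128) ⟹ (143)» ⇒ the same for the componentwise extensions on skew matrix-valued fields -/

variable [Fintype κ] [DecidableEq κ] [Fintype n] [DecidableEq n]

/-- ★★ **GENERIC TRANSFER OF «(128) ⟹ (143)» TO THE MATRIX CARRIER.**  Let `Δ, G̃ : (ι → ℝ) → (ι → ℝ)`, `Q : (ι → ℝ) → (κ → ℝ)`, `H : (κ → ℝ) → (ι → ℝ)` be real-linear
scalar operators for which the scalar implication holds: whenever `Σ_j y_j·((Δx)_j + v_j) = 0` for all `y ∈ ker Q`, then `x − H(Qx) = −G̃v`.  Let `Δ_V, Q_V, H_V, G̃_V` be their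
componentwise ℂ-linear extensions to `M_N(ℂ)`-valued fields (kernel formula).  Then for skew-Hermitian `A′`, `w`: if `Σ_j Re tr(δ_j*((Δ_VA′)_j + w_j)) = 0` for every
skew-Hermitian test field `δ` with `Q_Vδ = 0` (print's (128) with the pairing (27) on Lie-algebra-valued fields), then `A′ − H_V(Q_VA′) = −G̃_V w` ((133)∕(143)).
Proof: the skew test fields `y·(E_{ii′} − E_{i′i})`, `y·i(E_{ii′} + E_{i′i})`, `y ∈ ker Q`, reduce the hypothesis to the scalar one for each of the `2N²` real components.
[cite: Balaban1985Variational, (127)–(133) pp.297–298, (143) p.300, p.288] -/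
theorem eq143_matrix_of_scalar (dlt gt : (ι → ℝ) →ₗ[ℝ] (ι → ℝ)) (q : (ι → ℝ) →ₗ[ℝ] (κ → ℝ)) (h : (κ → ℝ) →ₗ[ℝ] (ι → ℝ))
    {DV GV : (ι → Matrix n n ℂ) →ₗ[ℂ] (ι → Matrix n n ℂ)} {QV : (ι → Matrix n n ℂ) →ₗ[ℂ] (κ → Matrix n n ℂ)}
    {HV : (κ → Matrix n n ℂ) →ₗ[ℂ] (ι → Matrix n n ℂ)}
    (hDV : ∀ (A : ι → Matrix n n ℂ) (b : ι), DV A b = ∑ j, ((dlt (Pi.single j 1) b : ℝ) : ℂ) • A j)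
    (hGV : ∀ (A : ι → Matrix n n ℂ) (b : ι), GV A b = ∑ j, ((gt (Pi.single j 1) b : ℝ) : ℂ) • A j)
    (hQV : ∀ (A : ι → Matrix n n ℂ) (t : κ), QV A t = ∑ j, ((q (Pi.single j 1) t : ℝ) : ℂ) • A j)
    (hHV : ∀ (B : κ → Matrix n n ℂ) (b : ι), HV B b = ∑ t, ((h (Pi.single t 1) b : ℝ) : ℂ) • B t)
    (hscalar : ∀ x v : ι → ℝ, (∀ y : ι → ℝ, q y = 0 → ∑ j, y j * (dlt x j + v j) = 0) → x - h (q x) = -(gt v))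
    {A' w : ι → Matrix n n ℂ} (hA : ∀ j, (A' j)ᴴ = -A' j) (hw : ∀ j, (w j)ᴴ = -w j)
    (h128 : ∀ δ : ι → Matrix n n ℂ, (∀ j, (δ j)ᴴ = -δ j) → QV δ = 0 → ∑ j, ((δ j)ᴴ * (DV A' j + w j)).trace.re = 0) :
    A' - HV (QV A') = -(GV w) := by
  -- `E := Δ_V A′ + w` is skew-valued
  have hE : ∀ j, (DV A' j + w j)ᴴ = -(DV A' j + w j) := fun j => by
    rw [Matrix.conjTranspose_add, extension_skew dlt hDV hA j, hw j, neg_add]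
  -- a test field `y·B` with `q y = 0` is `Q_V`-null
  have hQnull : ∀ (y : ι → ℝ), q y = 0 → ∀ B : Matrix n n ℂ, QV (fun j => ((y j : ℝ) : ℂ) • B) = 0 := fun y hy B => by
    funext t
    rw [extension_real_smul q hQV y B t, hy, Pi.zero_apply, Pi.zero_apply, Complex.ofReal_zero, zero_smul]
  -- the scalar hypothesis for the real and imaginary part of each entry
  have hre : ∀ i i' : n, ∀ y : ι → ℝ, q y = 0 →
      ∑ j, y j * (dlt (fun k => (A' k i i').re) j + (w j i i').re) = 0 := by
    intro i i' y hy
    have h0 := h128 (fun j => ((y j : ℝ) : ℂ) • (Matrix.single i i' (1 : ℂ) - Matrix.single i' i (1 : ℂ)))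
      (fun j => testRe_skew (y j) i i') (hQnull y hy _)
    simp only [re_trace_testRe] at h0
    have h1 : ∑ j, y j * (((DV A' j + w j) i i').re - ((DV A' j + w j) i' i).re) = ∑ j, 2 * (y j * ((DV A' j + w j) i i').re) :=
      Finset.sum_congr rfl fun j _ => by rw [(skew_entries (hE j) i i').1]; ring
    rw [h1, ← Finset.mul_sum] at h0
    have h2 : ∑ j, y j * ((DV A' j + w j) i i').re = 0 := by linarith
    rw [← h2]
    refine Finset.sum_congr rfl fun j _ => ?_
    rw [Matrix.add_apply, Complex.add_re, extension_entry_re dlt hDV A' j i i']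
  have him : ∀ i i' : n, ∀ y : ι → ℝ, q y = 0 →
      ∑ j, y j * (dlt (fun k => (A' k i i').im) j + (w j i i').im) = 0 := by
    intro i i' y hy
    have h0 := h128 (fun j => ((y j : ℝ) : ℂ) • (Matrix.single i i' Complex.I + Matrix.single i' i Complex.I))
      (fun j => testIm_skew (y j) i i') (hQnull y hy _)
    simp only [re_trace_testIm] at h0
    have h1 : ∑ j, y j * (((DV A' j + w j) i i').im + ((DV A' j + w j) i' i).im) = ∑ j, 2 * (y j * ((DV A' j + w j) i i').im) :=
      Finset.sum_congr rfl fun j _ => by rw [(skew_entries (hE j) i i').2]; ring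
    rw [h1, ← Finset.mul_sum] at h0
    have h2 : ∑ j, y j * ((DV A' j + w j) i i').im = 0 := by linarith
    rw [← h2]
    refine Finset.sum_congr rfl fun j _ => ?_
    rw [Matrix.add_apply, Complex.add_im, extension_entry_im dlt hDV A' j i i']
  -- the scalar conclusion per component, reassembled entrywise
  funext b
  ext i i'
  have hcr := congrFun (hscalar (fun k => (A' k i i').re) (fun k => (w k i i').re) (hre i i')) b
  have hci := congrFun (hscalar (fun k => (A' k i i').im) (fun k => (w k i i').im) (him i i')) b
  simp only [Pi.sub_apply, Pi.neg_apply] at hcr hci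
  apply Complex.ext
  · rw [Pi.sub_apply, Matrix.sub_apply, Complex.sub_re, Pi.neg_apply, Matrix.neg_apply, Complex.neg_re,
      extension_entry_re gt hGV w b i i', extension_entry_re h hHV (QV A') b i i']
    have hq : (fun t => (QV A' t i i').re) = q (fun k => (A' k i i').re) := funext fun t => extension_entry_re q hQV A' t i i'
    rw [hq]
    exact hcr
  · rw [Pi.sub_apply, Matrix.sub_apply, Complex.sub_im, Pi.neg_apply, Matrix.neg_apply, Complex.neg_im,
      extension_entry_im gt hGV w b i i', extension_entry_im h hHV (QV A') b i i']
    have hq : (fun t => (QV A' t i i').im) = q (fun k => (A' k i i').im) := funext fun t => extension_entry_im q hQV A' t i i'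
    rw [hq]
    exact hci

/-- ★ **THE (158) SHAPE ON THE MATRIX CARRIER**: under the hypotheses of `eq143_matrix_of_scalar` with `w = W(A′)` for a map `W` (print's `(δ∕δA′)V`), `A₁ := A′ − H_V(Q_VA′)` solves
*«A₁ + G̃((δ∕δA′)V)(A₁ + HB) = 0. (158)»*, `B = Q_VA′`. [cite: Balaban1985Variational, (158) p.302, (143) p.300] -/
theorem eq158_matrix_of_scalar (dlt gt : (ι → ℝ) →ₗ[ℝ] (ι → ℝ)) (q : (ι → ℝ) →ₗ[ℝ] (κ → ℝ)) (h : (κ → ℝ) →ₗ[ℝ] (ι → ℝ))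
    {DV GV : (ι → Matrix n n ℂ) →ₗ[ℂ] (ι → Matrix n n ℂ)} {QV : (ι → Matrix n n ℂ) →ₗ[ℂ] (κ → Matrix n n ℂ)}
    {HV : (κ → Matrix n n ℂ) →ₗ[ℂ] (ι → Matrix n n ℂ)}
    (hDV : ∀ (A : ι → Matrix n n ℂ) (b : ι), DV A b = ∑ j, ((dlt (Pi.single j 1) b : ℝ) : ℂ) • A j)
    (hGV : ∀ (A : ι → Matrix n n ℂ) (b : ι), GV A b = ∑ j, ((gt (Pi.single j 1) b : ℝ) : ℂ) • A j)
    (hQV : ∀ (A : ι → Matrix n n ℂ) (t : κ), QV A t = ∑ j, ((q (Pi.single j 1) t : ℝ) : ℂ) • A j)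
    (hHV : ∀ (B : κ → Matrix n n ℂ) (b : ι), HV B b = ∑ t, ((h (Pi.single t 1) b : ℝ) : ℂ) • B t)
    (hscalar : ∀ x v : ι → ℝ, (∀ y : ι → ℝ, q y = 0 → ∑ j, y j * (dlt x j + v j) = 0) → x - h (q x) = -(gt v))
    (W : (ι → Matrix n n ℂ) → (ι → Matrix n n ℂ)) {A' : ι → Matrix n n ℂ} (hA : ∀ j, (A' j)ᴴ = -A' j) (hW : ∀ j, (W A' j)ᴴ = -(W A' j))
    (h128 : ∀ δ : ι → Matrix n n ℂ, (∀ j, (δ j)ᴴ = -δ j) → QV δ = 0 → ∑ j, ((δ j)ᴴ * (DV A' j + W A' j)).trace.re = 0) :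
    (A' - HV (QV A')) + GV (W ((A' - HV (QV A')) + HV (QV A'))) = 0 := by
  rw [sub_add_cancel, eq143_matrix_of_scalar dlt gt q h hDV hGV hQV hHV hscalar hA hW h128, neg_add_cancel]

end Generic

/-! ## §2  ★★ File 5's flat multi-level operators of a nested family `D`, transferred to the matrix carrier -/

section FlatOps

open Literature.MathematicalPhysics.QuantumFieldTheory.Balaban1983to89
open Literature.MathematicalPhysics.QuantumFieldTheory.Balaban1983to89.T4Continuum (T4Family)
open Literature.MathematicalPhysics.QuantumFieldTheory.BalabanImbrieJaffe1984to88.BIJ85AxialPropagator411 (BondSpace)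
open B6SectADomainsV1 (Domains)
open B6SectAOperatorsV1 (BondIdx BondIdxSpace QE QsE)
open B6SectAVectorModelV1 (deltaAE GE EE)
open B6SectA (hOp)
open Summit.QuantumFields.YangMills.Theorems.K0Stub1Eq158FlatOpsAtRecord (eq143_of_critical128_flatOps)

variable {P : Params} (D : Domains P) {c : ℝ} {w : BondIdx D → ℝ} {n : Type*} [Fintype n] [DecidableEq n]

open scoped Classical in
omit [Fintype n] [DecidableEq n] in
/-- **A6 — THE EXTENSION HYPOTHESES BELOW ARE INHABITED**: the componentwise ℂ-linear extensions `Δ_{a,V}`, `G̃_V`, `Q_V`, `H_V` of lit-balaban's `deltaAE D c w`, print's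
`G̃ = GE − hOp∘QE∘GE`, `QE D` and `hOp (GE D) (QsE D) (EE D)` to `M_N(ℂ)`-valued fields EXIST with the displayed kernel formulas (UST `FlatScalarExtension.exists_extension`
at the plain-function editions of the four scalar operators). [cite: Balaban1985Variational, p.288 («suppressed matrix indices»), (156)–(158) p.302] -/
theorem exists_extensions_flatOps (hc : c ≠ 0) (hw : ∀ i, 0 < w i) :
    ∃ (DV GV : (PBond P 0 → Matrix n n ℂ) →ₗ[ℂ] (PBond P 0 → Matrix n n ℂ)) (QV : (PBond P 0 → Matrix n n ℂ) →ₗ[ℂ] (BondIdx D → Matrix n n ℂ))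
      (HV : (BondIdx D → Matrix n n ℂ) →ₗ[ℂ] (PBond P 0 → Matrix n n ℂ)),
      (∀ (A : PBond P 0 → Matrix n n ℂ) (b : PBond P 0),
          DV A b = ∑ j, ((WithLp.ofLp (deltaAE D c w (WithLp.toLp 2 (Pi.single j 1))) b : ℝ) : ℂ) • A j) ∧
        (∀ (A : PBond P 0 → Matrix n n ℂ) (b : PBond P 0),
          GV A b = ∑ j, ((WithLp.ofLp ((GE D hc hw - hOp (GE D hc hw) (QsE D) (EE D hc hw) ∘ₗ QE D ∘ₗ GE D hc hw)
            (WithLp.toLp 2 (Pi.single j 1))) b : ℝ) : ℂ) • A j) ∧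
        (∀ (A : PBond P 0 → Matrix n n ℂ) (t : BondIdx D),
          QV A t = ∑ j, ((WithLp.ofLp (QE D (WithLp.toLp 2 (Pi.single j 1))) t : ℝ) : ℂ) • A j) ∧
        ∀ (B : BondIdx D → Matrix n n ℂ) (b : PBond P 0),
          HV B b = ∑ t, ((WithLp.ofLp (hOp (GE D hc hw) (QsE D) (EE D hc hw) (WithLp.toLp 2 (Pi.single t 1))) b : ℝ) : ℂ) • B t := by
  obtain ⟨DV, hDV⟩ := exists_extension
    ((WithLp.linearEquiv 2 ℝ (PBond P 0 → ℝ)).toLinearMap ∘ₗ deltaAE D c w ∘ₗ (WithLp.linearEquiv 2 ℝ (PBond P 0 → ℝ)).symm.toLinearMap)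
    (Matrix n n ℂ)
  obtain ⟨GV, hGV⟩ := exists_extension
    ((WithLp.linearEquiv 2 ℝ (PBond P 0 → ℝ)).toLinearMap ∘ₗ (GE D hc hw - hOp (GE D hc hw) (QsE D) (EE D hc hw) ∘ₗ QE D ∘ₗ GE D hc hw) ∘ₗ
      (WithLp.linearEquiv 2 ℝ (PBond P 0 → ℝ)).symm.toLinearMap) (Matrix n n ℂ)
  obtain ⟨QV, hQV⟩ := exists_extension
    ((WithLp.linearEquiv 2 ℝ (BondIdx D → ℝ)).toLinearMap ∘ₗ QE D ∘ₗ (WithLp.linearEquiv 2 ℝ (PBond P 0 → ℝ)).symm.toLinearMap) (Matrix n n ℂ)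
  obtain ⟨HV, hHV⟩ := exists_extension
    ((WithLp.linearEquiv 2 ℝ (PBond P 0 → ℝ)).toLinearMap ∘ₗ hOp (GE D hc hw) (QsE D) (EE D hc hw) ∘ₗ
      (WithLp.linearEquiv 2 ℝ (BondIdx D → ℝ)).symm.toLinearMap) (Matrix n n ℂ)
  simp only [LinearMap.comp_apply, LinearEquiv.coe_coe, WithLp.coe_linearEquiv, WithLp.coe_symm_linearEquiv] at hDV hGV hQV hHV
  exact ⟨DV, GV, QV, HV, hDV, hGV, hQV, hHV⟩

open scoped Classical in
/-- ★★ **[15] (128) ⟹ (133)∕(143) WITH PRINT's MULTI-LEVEL FLAT OPERATORS, ON MATRIX-VALUED BOND FIELDS.**  For every nested domain family `D` on the Setup torus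
(the cube sequence (144) included), lattice factor `c ≠ 0`, weights `w > 0`, and every quadruple of componentwise ℂ-linear extensions `Δ_{a,V}`, `G̃_V`, `Q_V`, `H_V`
(kernel formula of UST `FlatScalarExtension`) of lit-balaban's `Δ_a = deltaAE D c w` ([B6] (2.19)), print's `G̃ = G − HQG` (`GE D − hOp∘QE D∘GE D`), the multi-level
constraints `Q = QE D` ((156)–(157)) and print's `H = GQ*(QGQ*)⁻¹` (`hOp (GE D) (QsE D) (EE D)`, (45)∕(157)): if `A′`, `w` are skew-Hermitian-valued and
`Σ_b Re tr(δ_b*((Δ_{a,V}A′)_b + w_b)) = 0` for every skew-Hermitian test field with `Q_Vδ = 0` ((128) with the pairing (27)), then `A′ − H_V(Q_VA′) = −G̃_V w`.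
File 5's `eq143_of_critical128_flatOps` through §1's generic transfer. [cite: Balaban1985Variational, (127)–(133) pp.297–298, (143) p.300, (156)–(157) p.302, p.288; Balaban1984PropagatorsII, (2.19)–(2.22) p.226] -/
theorem eq143_flatOps_matrixFields (hc : c ≠ 0) (hw : ∀ i, 0 < w i)
    {DV GV : (PBond P 0 → Matrix n n ℂ) →ₗ[ℂ] (PBond P 0 → Matrix n n ℂ)} {QV : (PBond P 0 → Matrix n n ℂ) →ₗ[ℂ] (BondIdx D → Matrix n n ℂ)}
    {HV : (BondIdx D → Matrix n n ℂ) →ₗ[ℂ] (PBond P 0 → Matrix n n ℂ)}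
    (hDV : ∀ (A : PBond P 0 → Matrix n n ℂ) (b : PBond P 0),
      DV A b = ∑ j, ((WithLp.ofLp (deltaAE D c w (WithLp.toLp 2 (Pi.single j 1))) b : ℝ) : ℂ) • A j)
    (hGV : ∀ (A : PBond P 0 → Matrix n n ℂ) (b : PBond P 0),
      GV A b = ∑ j, ((WithLp.ofLp ((GE D hc hw - hOp (GE D hc hw) (QsE D) (EE D hc hw) ∘ₗ QE D ∘ₗ GE D hc hw)
        (WithLp.toLp 2 (Pi.single j 1))) b : ℝ) : ℂ) • A j)
    (hQV : ∀ (A : PBond P 0 → Matrix n n ℂ) (t : BondIdx D),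
      QV A t = ∑ j, ((WithLp.ofLp (QE D (WithLp.toLp 2 (Pi.single j 1))) t : ℝ) : ℂ) • A j)
    (hHV : ∀ (B : BondIdx D → Matrix n n ℂ) (b : PBond P 0),
      HV B b = ∑ t, ((WithLp.ofLp (hOp (GE D hc hw) (QsE D) (EE D hc hw) (WithLp.toLp 2 (Pi.single t 1))) b : ℝ) : ℂ) • B t)
    {A' v : PBond P 0 → Matrix n n ℂ} (hA : ∀ j, (A' j)ᴴ = -A' j) (hv : ∀ j, (v j)ᴴ = -v j)
    (h128 : ∀ δ : PBond P 0 → Matrix n n ℂ, (∀ j, (δ j)ᴴ = -δ j) → QV δ = 0 → ∑ j, ((δ j)ᴴ * (DV A' j + v j)).trace.re = 0) :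
    A' - HV (QV A') = -(GV v) := by
  -- plain-function editions of the four scalar operators (`BondSpace P = EuclideanSpace ℝ (PBond P 0)` ↔ `PBond P 0 → ℝ` by `WithLp.linearEquiv`)
  refine eq143_matrix_of_scalar
    ((WithLp.linearEquiv 2 ℝ (PBond P 0 → ℝ)).toLinearMap ∘ₗ deltaAE D c w ∘ₗ (WithLp.linearEquiv 2 ℝ (PBond P 0 → ℝ)).symm.toLinearMap)
    ((WithLp.linearEquiv 2 ℝ (PBond P 0 → ℝ)).toLinearMap ∘ₗ (GE D hc hw - hOp (GE D hc hw) (QsE D) (EE D hc hw) ∘ₗ QE D ∘ₗ GE D hc hw) ∘ₗ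
      (WithLp.linearEquiv 2 ℝ (PBond P 0 → ℝ)).symm.toLinearMap)
    ((WithLp.linearEquiv 2 ℝ (BondIdx D → ℝ)).toLinearMap ∘ₗ QE D ∘ₗ (WithLp.linearEquiv 2 ℝ (PBond P 0 → ℝ)).symm.toLinearMap)
    ((WithLp.linearEquiv 2 ℝ (PBond P 0 → ℝ)).toLinearMap ∘ₗ hOp (GE D hc hw) (QsE D) (EE D hc hw) ∘ₗ
      (WithLp.linearEquiv 2 ℝ (BondIdx D → ℝ)).symm.toLinearMap)
    (fun A b => ?_) (fun A b => ?_) (fun A t => ?_) (fun B b => ?_) (fun x u hx => ?_) hA hv h128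
  · simp only [LinearMap.comp_apply, LinearEquiv.coe_coe, WithLp.coe_linearEquiv, WithLp.coe_symm_linearEquiv]; exact hDV A b
  · simp only [LinearMap.comp_apply, LinearEquiv.coe_coe, WithLp.coe_linearEquiv, WithLp.coe_symm_linearEquiv]; exact hGV A b
  · simp only [LinearMap.comp_apply, LinearEquiv.coe_coe, WithLp.coe_linearEquiv, WithLp.coe_symm_linearEquiv]; exact hQV A t
  · simp only [LinearMap.comp_apply, LinearEquiv.coe_coe, WithLp.coe_linearEquiv, WithLp.coe_symm_linearEquiv]; exact hHV B b
  -- file 5's scalar theorem, transported along `ofLp ∕ toLp`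
  simp only [LinearMap.comp_apply, LinearEquiv.coe_coe, WithLp.coe_linearEquiv, WithLp.coe_symm_linearEquiv, WithLp.toLp_ofLp] at hx ⊢
  have h5 := eq143_of_critical128_flatOps D hc hw (A' := WithLp.toLp 2 x) (v := WithLp.toLp 2 u) ?_
  · have h6 := congrArg WithLp.ofLp h5
    rw [WithLp.ofLp_sub, WithLp.ofLp_toLp, WithLp.ofLp_neg] at h6
    exact h6
  · intro δ hδ
    have hy := hx (WithLp.ofLp δ) (by rw [WithLp.toLp_ofLp, LinearMap.mem_ker.mp hδ, WithLp.ofLp_zero])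
    rw [WithLp.toLp_ofLp] at hy
    rw [EuclideanSpace.inner_eq_star_dotProduct, star_trivial, dotProduct, ← hy]
    refine Finset.sum_congr rfl fun j _ => ?_
    rw [mul_comm, WithLp.ofLp_add, Pi.add_apply, WithLp.ofLp_toLp]

open scoped Classical in
/-- ★★ **[15] (127)∕(128) ⟹ (158) WITH PRINT's MULTI-LEVEL FLAT OPERATORS, ON MATRIX-VALUED BOND FIELDS**: under the hypotheses of `eq143_flatOps_matrixFields` with
`w = W(A′)` (print's `(δ∕δA′)V`), the tangent component `A₁ := A′ − H_V(Q_VA′)` solves *«A₁ + G̃((δ∕δA′)V)(A₁ + HB) = 0. (158)»*, `B = Q_VA′` — with the SAME ℂ-linear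
operator `G̃_V` on `PBond P 0 → M_N(ℂ)` that UST's Prop. 6 (`FlatSmallSolution158*`, g0 file 1 at the record) consumes. [cite: Balaban1985Variational, (158) p.302, (143) p.300, (156)–(157) p.302] -/
theorem eq158_flatOps_matrixFields (hc : c ≠ 0) (hw : ∀ i, 0 < w i)
    {DV GV : (PBond P 0 → Matrix n n ℂ) →ₗ[ℂ] (PBond P 0 → Matrix n n ℂ)} {QV : (PBond P 0 → Matrix n n ℂ) →ₗ[ℂ] (BondIdx D → Matrix n n ℂ)}
    {HV : (BondIdx D → Matrix n n ℂ) →ₗ[ℂ] (PBond P 0 → Matrix n n ℂ)}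
    (hDV : ∀ (A : PBond P 0 → Matrix n n ℂ) (b : PBond P 0),
      DV A b = ∑ j, ((WithLp.ofLp (deltaAE D c w (WithLp.toLp 2 (Pi.single j 1))) b : ℝ) : ℂ) • A j)
    (hGV : ∀ (A : PBond P 0 → Matrix n n ℂ) (b : PBond P 0),
      GV A b = ∑ j, ((WithLp.ofLp ((GE D hc hw - hOp (GE D hc hw) (QsE D) (EE D hc hw) ∘ₗ QE D ∘ₗ GE D hc hw)
        (WithLp.toLp 2 (Pi.single j 1))) b : ℝ) : ℂ) • A j)
    (hQV : ∀ (A : PBond P 0 → Matrix n n ℂ) (t : BondIdx D),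
      QV A t = ∑ j, ((WithLp.ofLp (QE D (WithLp.toLp 2 (Pi.single j 1))) t : ℝ) : ℂ) • A j)
    (hHV : ∀ (B : BondIdx D → Matrix n n ℂ) (b : PBond P 0),
      HV B b = ∑ t, ((WithLp.ofLp (hOp (GE D hc hw) (QsE D) (EE D hc hw) (WithLp.toLp 2 (Pi.single t 1))) b : ℝ) : ℂ) • B t)
    (W : (PBond P 0 → Matrix n n ℂ) → (PBond P 0 → Matrix n n ℂ)) {A' : PBond P 0 → Matrix n n ℂ} (hA : ∀ j, (A' j)ᴴ = -A' j)
    (hW : ∀ j, (W A' j)ᴴ = -(W A' j))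
    (h128 : ∀ δ : PBond P 0 → Matrix n n ℂ, (∀ j, (δ j)ᴴ = -δ j) → QV δ = 0 → ∑ j, ((δ j)ᴴ * (DV A' j + W A' j)).trace.re = 0) :
    (A' - HV (QV A')) + GV (W ((A' - HV (QV A')) + HV (QV A'))) = 0 := by
  rw [sub_add_cancel, eq143_flatOps_matrixFields D hc hw hDV hGV hQV hHV hA hW h128, neg_add_cancel]

open scoped Classical in
/-- ★ **AT THE RECORD's FINE TORUS** `Site (F.P K) 0` (`F : T4Family`), any nested family there (e.g. [15] Sect. F's collared cube sequence once S3 fixes it): (127) ⟹ (158)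
with print's explicit flat operators on `PBond (F.P K) 0 → M_N(ℂ)`. [cite: Balaban1985Variational, (144) p.300, (158) p.302; Balaban1987RG1, (0.1) p.251] -/
theorem eq158_flatOps_matrixFields_T4 (F : T4Family) (K : ℕ) (D : Domains (F.P K)) {c : ℝ} (hc : c ≠ 0) {w : BondIdx D → ℝ} (hw : ∀ i, 0 < w i)
    {DV GV : (PBond (F.P K) 0 → Matrix n n ℂ) →ₗ[ℂ] (PBond (F.P K) 0 → Matrix n n ℂ)}
    {QV : (PBond (F.P K) 0 → Matrix n n ℂ) →ₗ[ℂ] (BondIdx D → Matrix n n ℂ)} {HV : (BondIdx D → Matrix n n ℂ) →ₗ[ℂ] (PBond (F.P K) 0 → Matrix n n ℂ)}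
    (hDV : ∀ (A : PBond (F.P K) 0 → Matrix n n ℂ) (b : PBond (F.P K) 0),
      DV A b = ∑ j, ((WithLp.ofLp (deltaAE D c w (WithLp.toLp 2 (Pi.single j 1))) b : ℝ) : ℂ) • A j)
    (hGV : ∀ (A : PBond (F.P K) 0 → Matrix n n ℂ) (b : PBond (F.P K) 0),
      GV A b = ∑ j, ((WithLp.ofLp ((GE D hc hw - hOp (GE D hc hw) (QsE D) (EE D hc hw) ∘ₗ QE D ∘ₗ GE D hc hw)
        (WithLp.toLp 2 (Pi.single j 1))) b : ℝ) : ℂ) • A j)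
    (hQV : ∀ (A : PBond (F.P K) 0 → Matrix n n ℂ) (t : BondIdx D),
      QV A t = ∑ j, ((WithLp.ofLp (QE D (WithLp.toLp 2 (Pi.single j 1))) t : ℝ) : ℂ) • A j)
    (hHV : ∀ (B : BondIdx D → Matrix n n ℂ) (b : PBond (F.P K) 0),
      HV B b = ∑ t, ((WithLp.ofLp (hOp (GE D hc hw) (QsE D) (EE D hc hw) (WithLp.toLp 2 (Pi.single t 1))) b : ℝ) : ℂ) • B t)
    (W : (PBond (F.P K) 0 → Matrix n n ℂ) → (PBond (F.P K) 0 → Matrix n n ℂ)) {A' : PBond (F.P K) 0 → Matrix n n ℂ} (hA : ∀ j, (A' j)ᴴ = -A' j)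
    (hW : ∀ j, (W A' j)ᴴ = -(W A' j))
    (h128 : ∀ δ : PBond (F.P K) 0 → Matrix n n ℂ, (∀ j, (δ j)ᴴ = -δ j) → QV δ = 0 → ∑ j, ((δ j)ᴴ * (DV A' j + W A' j)).trace.re = 0) :
    (A' - HV (QV A')) + GV (W ((A' - HV (QV A')) + HV (QV A'))) = 0 :=
  eq158_flatOps_matrixFields D hc hw hDV hGV hQV hHV W hA hW h128

end FlatOps

end Summit.QuantumFields.YangMills.Theorems.K0Stub1Eq158FlatOpsMatrixFields

end
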